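import Summits.HodgeConjecture.HodgeConjecture.Theorems.VHCAbelianSchemesRoadSecantQuotientAnchorCMTensorPoint
import Summits.HodgeConjecture.HodgeConjecture.Theorems.Ring2AbelianAllOneAnchorWeilCarrierDefs
import Literature.AlgebraicGeometry.HodgeTheory.AbelianVarietyHOneExactness
import Literature.AlgebraicGeometry.HodgeTheory.AbelianVarietyMultiplicationPullback
import Literature.AlgebraicGeometry.HodgeTheory.KodairaEmbeddingHyperplaneClass
import HarnessLib

/-!
# Road b02 (`VHCAbelianSchemesRoad`, D-0059) — lane W1 of crux `SemiregularSheafRepresentativesTwAtDiag` (item stmt-HodgeConjecture-19787):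
# THE ONE-ANCHOR JUNCTION — 2a″ at ONE pinned secant–quotient anchor ⟹ the André column's node `OneHyperbolicWeilCarrier 𝒪 3 ((d+1)²·d)`
# (what the stub BUYS downstream; fact-free, the hyperplane-class pin displayed or supplied by Kodaira's theorem BY NAME)

research route conditional on HC_CM; not a corollary; Q11.4-sentence-2 already refuted in dim ≥ 3.

THEOREMS ONLY (no definition, no new named fact, no claim-tagged fact imported; `HC_CM` nowhere). Sequel of `…AnchorCMTensorPoint` (p530903:
`(Y_d, ψ_Y)` is a tensor point; 2a″ ⟸ the tensor node). The OPPOSITE direction of the ledger between the road and the Weil ladder ∕ André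
column: the column's SMALLEST carrier node `OneHyperbolicWeilCarrier 𝒪 n d` (ab-andre-2, `Ring2AbelianAllOneAnchorWeilCarrierDefs` p517971:
ONE hyperbolic `√−d`-Weil `2n`-fold `(P, ψ₀)` polarised by the `K`-symmetrised HYPERPLANE class `h_K = d·e^*a + ψ₀^*e^*a` of a projective
embedding, ONE rational Weil class `w`, and an `𝒪`-datum on every chart) is, at `n = 3`, «preprint-expected (Markman's secant sheaf)» — but no
kernel edge connected it to the road's stub 2a″, because the node packages its polarisation through `(e, a)` while the road pins
`θ = h_Y(θ₀)` (an ample-line class). This file supplies the edge: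

* §1 `isHyperbolicWeilType_descent` — HYPERBOLICITY DESCENDS along a cohomologically injective homomorphism `q : P → Y` with quasi-inverse
  (`q ≫ r = [N]`): `(P, ψ)` hyperbolic for `q^*h` ⟹ `(Y, r ≫ ψ ≫ q)` hyperbolic for `h` (the `2n` isotropic classes descend as `N⁻¹·r^*u_i`).
* §2 `IsSecantQuotientWeilClassAtPinned.smul` — the pinned anchor predicate is homogeneous under `θ ↦ c·θ`, `c ∈ ℚˣ` (the pin moves to
  `c·θ₀`, `h_Y` being linear; André's clauses, the ample line, hyperbolicity and «off the ray» are homogeneous).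
* §3 **`SecantQuotientDatum.oneHyperbolicWeilCarrier_of_anchoredCarrierAt_secantQuotientPinned`**: for a datum `D`, a polarisation class `θ₀` of
  `Θ` with the anchor clauses at the identity chart (relative to `D`) for `(h_Y(θ₀), γ)`, and a hyperplane-class pin `e^*a = h_Y(θ₀)`:
  `AnchoredCarrierAt 𝒪 6 3 𝔄^pin 𝔖^pin ⟹ OneHyperbolicWeilCarrier 𝒪 3 ((d+1)²·d)` with `P := Y`, `ψ₀ := ψ_Y`, `w := γ`; the node's
  `h_K` equals `2(d+1)²d·h_Y(θ₀)` (`ψ_Y^*h_Y(θ₀) = (d+1)²d·h_Y(θ₀)` from `q^*h_Y = Ξ_d`, `φ_d^*Ξ_d = d·Ξ_d`, `[d+1]^* = (d+1)²` on `H²`); the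
  Kodaira form `…_of_kodaira` takes `Kodaira1954_rationalKaehlerClass_eq_hyperplaneClass` (p527661, textbook fact) and a Kähler real multiple of
  `h_Y(θ₀)` instead of `(e, a)`; twisted ∀`C` form `…oneHyperbolicWeilTwistedCarrier_of_secantQuotientAnchorCarrier63Pinned`.

DOWNSTREAM (not re-derived here; `Ring2AbelianAllOneAnchorWeilCarrierRows` is a leaf file): door ∧ reach ∧ node ⟹ the Weil plane of EVERY
hyperbolic `(A, φ, h)` of dimension `6` with `φ² = −(d+1)²d` is algebraic (`weilClasses_algebraic_hyperbolic_of_reach_of_door_of_oneHyperbolicWeilCarrier`);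
with b02's P1″ (`exists_anchoredDatum_secantQuotientPinned_of_pinned`, modulo the claim-tagged L1″) supplying 2a″'s datum at print's own pinned
anchor in print's direction, this is the kernel rendering of Markman's Thm. 1.5.1 route «one secant sheaf ⟹ the hyperbolic component» in the
road's currency. HONEST: nothing here says 2a″, the node, L1″, Kodaira's theorem, any cell, K-SR♭∃, VHC, `HC_AV`, `HC_CM` or HC holds; the
hyperplane-class pin ∕ Kähler multiple is a displayed hypothesis (its discharge from the ample-line clause = Hartshorne II 7.6 + Voisin 7.10 is
the typer lemma «an ample divisor class has a Kähler multiple», not in the tree as a statement).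

References: [cite: Markman2025SecantWeil, §1.5 (p. 7), Thm. 1.4.1 and Thm. 1.5.1] [cite: vanGeemen1994HodgeAV, Lemma 5.2 (2)–(3), 5.4 and proof of Thm. 6.12]
[cite: Deligne1982HodgeCycles, §4 proof of Thm. 4.8] [cite: MumfordAV1970, §19 (Remark p. 169)] [cite: Huybrechts2005, Prop. 5.3.1, Cor. 5.3.3]
[cite: VoisinHodgeI2002, Thm. 7.10, Thm. 7.11] [cite: Bloch1972Semiregularity, Remark (7.5)] [cite: BuchweitzFlenner2003, §5 Thm. 5.1].
-/

noncomputable section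

open CategoryTheory CategoryTheory.Limits AlgebraicGeometry Topology

namespace Summit.HodgeConjecture.HodgeConjecture.Ring2.SemiregularRepresentatives

set_option linter.dupNamespace false -- the cell's namespace repeats the summit name, as in every `Ring2*` file

open Literature.AlgebraicGeometry Literature.AlgebraicGeometry.Motives Literature.AlgebraicGeometry.Motives.AbelianVariety
open Literature.AlgebraicGeometry.HodgeTheory Literature.AlgebraicGeometry.Markman2025
open Literature.AlgebraicTopology.SingularHomology
open Summit.Ventures.HSemireg (ObjClass LocalVariationalHodgeFor)
open Summit.HodgeConjecture.HodgeConjecture.Ring2.AbelianAll (hyperbolicAnchorChart hyperbolicAnchorServed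
  OneHyperbolicWeilCarrier OneHyperbolicWeilTwistedCarrier)

/-! ## §1 Hyperbolicity descends along an isogeny with a quasi-inverse -/

section Descent

variable {P Y : AbelianVariety ℂ}

/-- Pull-back along a composite of THREE homomorphisms, applied form: `(f ≫ g ≫ k)^* x = f^*(g^*(k^* x))`. [folklore] -/
theorem complexBetti_map_comp₃_apply {A B C E : AbelianVariety ℂ} (f : A ⟶ B) (g : B ⟶ C) (k : C ⟶ E) (i : ℕ)
    (x : complexBetti E.X i) :
    complexBetti.map (f ≫ g ≫ k).hom.hom.hom i x =
      complexBetti.map f.hom.hom.hom i (complexBetti.map g.hom.hom.hom i (complexBetti.map k.hom.hom.hom i x)) := by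
  rw [complexBetti_map_comp_hom, complexBetti_map_comp_hom]
  rfl

/-- **HYPERBOLICITY DESCENDS ALONG AN ISOGENY WITH A QUASI-INVERSE.** Let `q : P → Y` be a homomorphism, injective on complex cohomology in every
degree, with `q ≫ r = [N]`, `N ≥ 1`, and `ψ` an endomorphism of `P`. If `(P, ψ)` is of hyperbolic Weil type (`n`) for the pulled-back class
`q^*h`, then `(Y, r ≫ ψ ≫ q)` is of hyperbolic Weil type for `h`: the `2n` rational independent `ψ^*`-stable `q^*h`-isotropic classes
`u_i ∈ H¹(P)` descend to `v_i := N⁻¹·r^*u_i` (`q^*v_i = u_i` since `q^*r^* = [N]^* = N` on `H¹`), which are rational, independent,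
`(rψq)^*`-stable (`(rψq)^*v_i = r^*ψ^*u_i ∈ r^*⟨u⟩ = ⟨N·v⟩`) and `h`-isotropic (`q^*` is injective on the top-degree pairing and natural).
[cite: vanGeemen1994HodgeAV, Lemma 5.2 (2)–(3) and 5.4] [cite: MumfordAV1970, §19 (Remark p. 169)] -/
theorem isHyperbolicWeilType_descent {ψ : P ⟶ P} {q : P ⟶ Y} {r : Y ⟶ P} {N n : ℕ} (hN : N ≠ 0)
    (hqr : q ≫ r = N • 𝟙 P) (hqinj : ∀ k, Function.Injective (complexBetti.map q.hom.hom.hom k)) {h : complexBetti Y.X 2}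
    (hh : IsHyperbolicWeilType P ψ n (complexBetti.map q.hom.hom.hom 2 h)) :
    IsHyperbolicWeilType Y (r ≫ ψ ≫ q) n h := by
  obtain ⟨u, huQ, hli, hstab, hiso⟩ := hh
  have hNC : (N : ℂ) ≠ 0 := Nat.cast_ne_zero.2 hN
  -- the descended classes
  let v : Fin (2 * n) → complexBetti Y.X 1 := fun i ↦ (((N : ℚ)⁻¹ : ℚ) : ℂ) • complexBetti.map r.hom.hom.hom 1 (u i)
  have hcast : (((N : ℚ)⁻¹ : ℚ) : ℂ) = (N : ℂ)⁻¹ := by push_cast; ring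
  have hru : ∀ i, complexBetti.map r.hom.hom.hom 1 (u i) = (N : ℂ) • v i := by
    intro i
    simp only [v, hcast, smul_smul, mul_inv_cancel₀ hNC, one_smul]
  have hqv : ∀ i, complexBetti.map q.hom.hom.hom 1 (v i) = u i := by
    intro i
    simp only [v, map_smul, complexBetti_map_map_one_of_comp_eq_nsmul_id hqr, hcast, smul_smul, inv_mul_cancel₀ hNC, one_smul]
  refine ⟨v, fun i ↦ ((huQ i).map _).smul _, ?_, fun i ↦ ?_, fun i j ↦ ?_⟩
  · -- independence: `q^* ∘ v = u`
    refine LinearIndependent.of_comp (complexBetti.map q.hom.hom.hom 1).hom ?_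
    have hcomp : ⇑(complexBetti.map q.hom.hom.hom 1).hom ∘ v = u := funext fun i ↦ hqv i
    rw [hcomp]
    exact hli
  · -- stability under `(r ≫ ψ ≫ q)^*`
    rw [complexBetti_map_comp₃_apply, hqv]
    have hsub : Submodule.map (complexBetti.map r.hom.hom.hom 1).hom (Submodule.span ℂ (Set.range u)) ≤
        Submodule.span ℂ (Set.range v) := by
      rw [Submodule.map_span]
      refine Submodule.span_le.2 ?_
      rintro _ ⟨_, ⟨j, rfl⟩, rfl⟩
      change complexBetti.map r.hom.hom.hom 1 (u j) ∈ _
      rw [hru j]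
      exact Submodule.smul_mem _ _ (Submodule.subset_span ⟨j, rfl⟩)
    exact hsub (Submodule.mem_map_of_mem (hstab i))
  · -- isotropy: push forward along the injective `q^*` in the top degree
    apply hqinj
    rw [map_polarizationPairingOne, hqv, hqv, hiso, map_zero]

end Descent

/-! ## §2 Rescaling the pinned polarisation -/

section Rescale

variable {X : SchemeOver ℂ} {θ : complexBetti X 2} {γ : complexBetti X (2 * 3)}

/-- `q^*(r^* x) = Nᵏ·x` on `Hᵏ` when `q ≫ r = [N]` (applied form of `[N]^* = Nᵏ`, `complexBetti_map_nsmul_id_apply`). [cite: MumfordAV1970, §19] -/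
theorem complexBetti_map_map_of_comp_eq_nsmul_id {A B : AbelianVariety ℂ} {t : A ⟶ B} {r : B ⟶ A} {N : ℕ} (hth : t ≫ r = N • 𝟙 A)
    (k : ℕ) (x : complexBetti A.X k) :
    complexBetti.map t.hom.hom.hom k (complexBetti.map r.hom.hom.hom k x) = ((N : ℂ) ^ k) • x := by
  have key := complexBetti_map_comp_hom t r k
  rw [hth] at key
  have hx := congrArg (fun φ : complexBetti A.X k ⟶ complexBetti A.X k => φ.hom x) key
  simp only [ModuleCat.hom_comp, LinearMap.comp_apply] at hx
  rw [← hx]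
  exact complexBetti_map_nsmul_id_apply A N k x

/-- **Rescaling the PINNED polarisation by a non-zero rational keeps a pinned-served class served**: the pin moves to the polarisation class
`c·θ₀` of `Θ` (`h_Y` is linear), André's polarisation clauses, the ample-line clause, hyperbolicity and «off the ray» are all homogeneous.
[cite: Markman2025SecantWeil, §1.5 (p. 7) and §9.3 (proof of Lemma 9.3.11)] [cite: vanGeemen1994HodgeAV, Lemma 5.2 and 5.4] -/
theorem IsSecantQuotientWeilClassAtPinned.smul (h : IsSecantQuotientWeilClassAtPinned X θ γ) {c : ℚ} (hc : c ≠ 0) :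
    IsSecantQuotientWeilClassAtPinned X ((c : ℂ) • θ) γ := by
  have hcC : (c : ℂ) ≠ 0 := by exact_mod_cast hc
  obtain ⟨D, e, θ₀, hθ₀, hpin, hpol, hamp, hW, hγQ, hray, hmem⟩ := h
  refine ⟨D, e, (c : ℂ) • θ₀, hθ₀.smul hc, ?_, ?_, ?_, ?_, hγQ, ?_, hmem⟩
  · rw [map_smul, hpin, SecantQuotientDatum.hY_def, SecantQuotientDatum.hY_def, secantPolarizationClass_smul]
    rfl
  · exact ⟨hpol.isRationalClass.smul c, Submodule.smul_mem _ _ hpol.mem_algebraicClasses,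
      HasHardLefschetzProperty.smul hpol.hasHardLefschetz hcC⟩
  · obtain ⟨H, hH, hHθ⟩ := hamp
    exact ⟨H, hH, by rw [map_smul]; exact hHθ.smul hc⟩
  · rw [map_smul, map_smul]
    exact (isHyperbolicWeilType_smul_iff hcC).2 hW
  · rw [cupPowTwo_smul, Submodule.span_singleton_smul_eq (pow_ne_zero 3 hcC).isUnit]
    exact hray

end Rescale

/-! ## §3 The junction: 2a″ at ONE pinned anchor ⟹ the André column's one-anchor node `OneHyperbolicWeilCarrier 𝒪 3 ((d+1)²d)` -/

section Junction

variable {𝒪 : ObjClass}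

/-- **2a″ AT ONE PINNED ANCHOR ⟹ THE ONE-ANCHOR WEIL-CARRIER NODE at `(3, (d+1)²·d)`** (`AbelianAll.OneHyperbolicWeilCarrier`, p517971).
Data: a secant–quotient datum `D`, a polarisation class `θ₀` of `Θ` with the anchor clauses at the identity chart of `Y` for `(h_Y(θ₀), γ)`
(`IsSecantQuotientWeilClassAtPinned.of_refl`'s inputs, relative to THIS datum), and a projective embedding `e` with a rational `a ≠ 0` such
that `e^*a = h_Y(θ₀)` (the output of Kodaira's embedding theorem for the ample-line class `h_Y(θ₀)`, `Kodaira1954_rationalKaehlerClass_eq_hyperplaneClass`;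
corollary below). Then the anchored-carrier statement `AnchoredCarrierAt 𝒪 6 3 𝔄^pin 𝔖^pin` (the door-generic body of 2a″) yields the node:
`P := Y`, `ψ₀ := ψ_Y = r ≫ φ_d ≫ q` (`ψ_Y² = −(d+1)²d`), `w := γ ∈ W(Y, ψ_Y, 3, (d+1)²d)`; the node's polarisation
`h_K = (d+1)²d·e^*a + ψ_Y^*e^*a` EQUALS `2(d+1)²d · h_Y(θ₀)` (`ψ_Y^*h_Y(θ₀) = (d+1)²d·h_Y(θ₀)` by `q^*h_Y = Ξ_d`, `φ_d^*Ξ_d = dΞ_d`,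
`[d+1]^* = (d+1)²` on `H²`); `(Y, ψ_Y)` is HYPERBOLIC for it (descent §1 from `(J × Ĵ, φ_d, Ξ_d)`, then homogeneity); and on every chart
`e'' : Y ≅ X` matching `θ'` with `h_K` and `w'` with `γ` the pair `(θ', w')` is pinned-served (§2 rescaling + `of_iso`), so 2a″ supplies the datum.
With the door and the reach fact, `Ring2AbelianAllOneAnchorWeilCarrierRows.weilClasses_algebraic_hyperbolic_of_reach_of_door_of_oneHyperbolicWeilCarrier`
then makes the Weil plane of EVERY hyperbolic `(A, φ, h)` of dimension `6` with `φ² = −(d+1)²d` algebraic (not re-derived here: leaf file).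
[cite: Markman2025SecantWeil, §1.5 (p. 7), Thm. 1.4.1 and Thm. 1.5.1] [cite: vanGeemen1994HodgeAV, Lemma 5.2, 5.4 and proof of Thm. 6.12]
[cite: Bloch1972Semiregularity, Remark (7.5)] [cite: MumfordAV1970, §19 (Remark p. 169)] -/
theorem SecantQuotientDatum.oneHyperbolicWeilCarrier_of_anchoredCarrierAt_secantQuotientPinned (D : SecantQuotientDatum)
    (h2a : AnchoredCarrierAt 𝒪 6 3 (fun X θ ↦ secantQuotientAnchorsPinned X θ) (fun X θ ↦ secantQuotientServedClassesPinned X θ))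
    {θ₀ : complexBetti D.𝒥.J.X 2} (hθ₀ : D.𝒥.J.IsPolarizationClassOf D.Θ θ₀) {γ : complexBetti D.Y.X (2 * 3)}
    (hpol : IsPolarizationClass 6 D.Y.X (D.hY θ₀))
    (hamp : ∃ H : CartierDivisor D.Y.X.left, H.IsAmple ∧ D.Y.IsPolarizationClassOf H (D.hY θ₀))
    (hW : IsHyperbolicWeilType D.P D.ψ 3 (complexBetti.map D.q.hom.hom.hom 2 (D.hY θ₀)))
    (hγQ : IsRationalClass γ) (hray : γ ∉ (ℂ ∙ cupPowTwo (D.hY θ₀) 3))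
    (hmem : complexBetti.map D.q.hom.hom.hom (2 * 3) γ ∈ weilClassesOf D.P D.ψ 3 D.d)
    (hea : ∃ (e : ProjectiveEmbedding D.Y.X) (a : complexBetti (projectiveSpace e.n ℂ) 2),
      IsRationalClass a ∧ a ≠ 0 ∧ complexBetti.map e.ι 2 a = D.hY θ₀) :
    OneHyperbolicWeilCarrier 𝒪 3 ((D.d + 1) ^ 2 * D.d) := by
  obtain ⟨r, hr⟩ := D.exists_q_comp_eq_nsmul_id
  have hd : 0 < D.d := by have := D.four_le; omega
  have hrq : r ≫ D.q = (D.d + 1) • 𝟙 D.Y := by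
    apply D.isIsogeny_q.cancel_left
    rw [← Category.assoc, hr, Preadditive.nsmul_comp, Category.id_comp, Preadditive.comp_nsmul, Category.comp_id]
  have hqinj : ∀ k, Function.Injective (complexBetti.map D.q.hom.hom.hom k) := fun k ↦ (D.complexBetti_map_q_bijective k).1
  -- the served class at the identity chart
  have hγ : IsSecantQuotientWeilClassAtPinned D.Y.X (D.hY θ₀) γ :=
    IsSecantQuotientWeilClassAtPinned.of_refl D hθ₀ hpol hamp hW hγQ hray hmem
  -- the Weil plane of `(Y, ψ_Y)`
  have hiff : ∀ b : complexBetti D.Y.X (2 * 3), complexBetti.map D.q.hom.hom.hom (2 * 3) b ∈ weilClassesOf D.P D.ψ 3 D.d ↔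
      b ∈ weilClassesOf D.Y (r ≫ D.ψ ≫ D.q) 3 ((D.d + 1) ^ 2 * D.d) := fun b ↦
    map_mem_weilClassesOf_iff_of_comp_eq_nsmul_comp D.isIsogeny_q (comp_conj_eq_nsmul_comp D.q r hr D.ψ) D.ψ_comp_ψ_nsmul hd
      (Nat.succ_pos D.d)
  -- `ψ_Y^* h_Y(θ₀) = (d+1)²d · h_Y(θ₀)`
  have hψθ : complexBetti.map (r ≫ D.ψ ≫ D.q).hom.hom.hom 2 (D.hY θ₀) = ((((D.d + 1) ^ 2 * D.d : ℕ)) : ℂ) • D.hY θ₀ := by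
    apply hqinj 2
    -- `φ_d^* Ξ_d(θ₀) = d · Ξ_d(θ₀)` read through `q^* h_Y(θ₀) = Ξ_d(θ₀)` (F5), stated on `q^* h_Y(θ₀)` itself
    have hΞ : complexBetti.map D.ψ.hom.hom.hom 2 (complexBetti.map D.q.hom.hom.hom 2 (D.hY θ₀)) =
        (D.d : ℂ) • complexBetti.map D.q.hom.hom.hom 2 (D.hY θ₀) := by
      rw [D.complexBetti_map_q_hY]
      exact complexBetti_map_weilOperator_weilPolarizationClass D.isAmple D.KTheta_eq_bot D.d θ₀
    rw [complexBetti_map_comp₃_apply, complexBetti_map_map_of_comp_eq_nsmul_id hr, hΞ, map_smul, smul_smul]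
    congr 1
    push_cast
    ring
  -- hyperbolicity of `(Y, ψ_Y)` for `h_Y(θ₀)`
  have hhypY : IsHyperbolicWeilType D.Y (r ≫ D.ψ ≫ D.q) 3 (D.hY θ₀) := isHyperbolicWeilType_descent (Nat.succ_ne_zero D.d) hr hqinj hW
  obtain ⟨e, a, ha, ha0, hea⟩ := hea
  -- the node's polarisation is `c · h_Y(θ₀)`, `c = 2(d+1)²d`
  have hc : ((2 * ((D.d + 1) ^ 2 * D.d) : ℕ) : ℚ) ≠ 0 := by
    have : 0 < 2 * ((D.d + 1) ^ 2 * D.d) := Nat.mul_pos two_pos (Nat.mul_pos (pow_pos (Nat.succ_pos D.d) 2) hd)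
    exact_mod_cast this.ne'
  have hcC : (((2 * ((D.d + 1) ^ 2 * D.d) : ℕ) : ℚ) : ℂ) ≠ 0 := by exact_mod_cast hc
  have hnode : ((((D.d + 1) ^ 2 * D.d : ℕ)) : ℂ) • complexBetti.map e.ι 2 a +
      complexBetti.map (r ≫ D.ψ ≫ D.q).hom.hom.hom 2 (complexBetti.map e.ι 2 a) =
        (((2 * ((D.d + 1) ^ 2 * D.d) : ℕ) : ℚ) : ℂ) • D.hY θ₀ := by
    rw [hea, hψθ, ← add_smul]
    congr 1
    push_cast
    ring
  refine ⟨D.Y, r ≫ D.ψ ≫ D.q, e, a, γ, D.dim_Y, conj_comp_conj D.q r hr hrq D.ψ_comp_ψ_nsmul, ha, ha0, ?_, (hiff γ).1 hmem, hγQ,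
    ?_, ?_⟩
  · rw [hnode]
    exact (isHyperbolicWeilType_smul_iff hcC).2 hhypY
  · intro h0
    exact hray (by rw [h0]; exact Submodule.zero_mem _)
  · rw [hnode]
    intro X θ' _ w' hw' hw'Q
    obtain ⟨e'', he''θ, he''w⟩ := hw'
    have hθ' : θ' = complexBetti.map e''.inv 2 ((((2 * ((D.d + 1) ^ 2 * D.d) : ℕ) : ℚ) : ℂ) • D.hY θ₀) := by
      rw [← he''θ, Iso.complexBetti_map_inv_map_hom]
    have hw'eq : w' = complexBetti.map e''.inv (2 * 3) γ := by rw [← he''w, Iso.complexBetti_map_inv_map_hom]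
    have hpin' : IsSecantQuotientWeilClassAtPinned X θ' w' := by
      rw [hθ', hw'eq]
      exact (hγ.smul hc).of_iso e''.symm
    exact h2a X θ' ⟨w', hpin'⟩ w' hpin' hw'Q

/-- **With Kodaira's embedding theorem BY NAME**: the hyperplane-class datum `(e, a)` of the previous theorem exists as soon as `h_Y(θ₀)` has a
Kähler real multiple (e.g. from its ample-line clause); so «2a″ at one pinned anchor ∧ Kodaira ∧ (Kähler multiple)» ⟹ the one-anchor node.
[cite: Huybrechts2005, Prop. 5.3.1, Cor. 5.3.3] [cite: VoisinHodgeI2002, Thm. 7.10, Thm. 7.11] [cite: Markman2025SecantWeil, Thm. 1.4.1] -/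
theorem SecantQuotientDatum.oneHyperbolicWeilCarrier_of_anchoredCarrierAt_secantQuotientPinned_of_kodaira (D : SecantQuotientDatum)
    (hK : Kodaira1954_rationalKaehlerClass_eq_hyperplaneClass)
    (h2a : AnchoredCarrierAt 𝒪 6 3 (fun X θ ↦ secantQuotientAnchorsPinned X θ) (fun X θ ↦ secantQuotientServedClassesPinned X θ))
    {θ₀ : complexBetti D.𝒥.J.X 2} (hθ₀ : D.𝒥.J.IsPolarizationClassOf D.Θ θ₀) {γ : complexBetti D.Y.X (2 * 3)}
    (hpol : IsPolarizationClass 6 D.Y.X (D.hY θ₀))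
    (hamp : ∃ H : CartierDivisor D.Y.X.left, H.IsAmple ∧ D.Y.IsPolarizationClassOf H (D.hY θ₀))
    (hKm : ∃ s : ℝ, s ≠ 0 ∧ IsKaehlerClass 6 D.Y.X ((s : ℂ) • D.hY θ₀))
    (hW : IsHyperbolicWeilType D.P D.ψ 3 (complexBetti.map D.q.hom.hom.hom 2 (D.hY θ₀)))
    (hγQ : IsRationalClass γ) (hray : γ ∉ (ℂ ∙ cupPowTwo (D.hY θ₀) 3))
    (hmem : complexBetti.map D.q.hom.hom.hom (2 * 3) γ ∈ weilClassesOf D.P D.ψ 3 D.d) :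
    OneHyperbolicWeilCarrier 𝒪 3 ((D.d + 1) ^ 2 * D.d) := by
  have hX : IsSmoothProjective 6 D.Y.X := D.dim_Y ▸ AbelianVariety.isSmoothProjective_holds (A := D.Y)
  obtain ⟨e, a, ha, ha0, hea⟩ := hK hX (by norm_num) (D.hY θ₀) hpol.isRationalClass hKm
  exact D.oneHyperbolicWeilCarrier_of_anchoredCarrierAt_secantQuotientPinned h2a hθ₀ hpol hamp hW hγQ hray hmem ⟨e, a, ha, ha0, hea⟩

/-- **Twisted door, every `C`: the stub 2a″ (`∀ C, SecantQuotientAnchorCarrier63Pinned C`) at one pinned anchor with a hyperplane-class pin ⟹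
`OneHyperbolicWeilTwistedCarrier 3 ((d+1)²·d)`.** [cite: Markman2025SecantWeil, Thm. 1.4.1, §1.5 and §7.3] [cite: Bloch1972Semiregularity, Remark (7.5)] -/
theorem SecantQuotientDatum.oneHyperbolicWeilTwistedCarrier_of_secantQuotientAnchorCarrier63Pinned (D : SecantQuotientDatum)
    (h2a : ∀ C : ChernCharacterBetti, SecantQuotientAnchorCarrier63Pinned C)
    {θ₀ : complexBetti D.𝒥.J.X 2} (hθ₀ : D.𝒥.J.IsPolarizationClassOf D.Θ θ₀) {γ : complexBetti D.Y.X (2 * 3)}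
    (hpol : IsPolarizationClass 6 D.Y.X (D.hY θ₀))
    (hamp : ∃ H : CartierDivisor D.Y.X.left, H.IsAmple ∧ D.Y.IsPolarizationClassOf H (D.hY θ₀))
    (hW : IsHyperbolicWeilType D.P D.ψ 3 (complexBetti.map D.q.hom.hom.hom 2 (D.hY θ₀)))
    (hγQ : IsRationalClass γ) (hray : γ ∉ (ℂ ∙ cupPowTwo (D.hY θ₀) 3))
    (hmem : complexBetti.map D.q.hom.hom.hom (2 * 3) γ ∈ weilClassesOf D.P D.ψ 3 D.d)
    (hea : ∃ (e : ProjectiveEmbedding D.Y.X) (a : complexBetti (projectiveSpace e.n ℂ) 2),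
      IsRationalClass a ∧ a ≠ 0 ∧ complexBetti.map e.ι 2 a = D.hY θ₀) :
    OneHyperbolicWeilTwistedCarrier 3 ((D.d + 1) ^ 2 * D.d) :=
  fun C ↦ D.oneHyperbolicWeilCarrier_of_anchoredCarrierAt_secantQuotientPinned (h2a C) hθ₀ hpol hamp hW hγQ hray hmem hea

end Junction

end Summit.HodgeConjecture.HodgeConjecture.Ring2.SemiregularRepresentatives

end
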